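import Summits.BirchSwinnertonDyer.BirchSwinnertonDyer.Theorems.EisensteinPrimesBSDpOnCellCTelescopeK2ControlOfCoefficients
import Summits.BirchSwinnertonDyer.BirchSwinnertonDyer.Theorems.EisensteinPrimesBSDpOnCellCTelescopeK2FixedTorsionFiniteSplitMult
import Literature.NumberTheory.GaloisRepresentations.DecompositionGroupOfCompletion
import HarnessLib

/-!
# Crux 4 `BSDpOnCellC` (stmt-BirchSwinnertonDyer-19034), line `telescope`, leaf N2 `stub_weightTwoControl`: SUB-LEAF W2
# `stub_weightTwoControlMap` (the weight-two control map `α : X₂/(C X)X₂ → Sel(M₂[C X])^∨` with torsion kernel and finite cokernel)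
# FROM N1's FIBRE DATA (tor)/(cof₀)/(unr)/(fd₀) PLUS TWO EXPLICIT EXTRA HYPOTHESES — (split) `E` SPLIT multiplicative at `p`, and
# (inert) an inertia clause at the ramified primes — on the objects `(κ, ρ₂, 𝔭bar, ∅)` (helper, `--supports stmt-BirchSwinnertonDyer-19034
# --as helper`; closes nothing; NOT the registered text: two hypotheses more, road-R-β prefix replaced by the object-level data it supplies)

Cell `bsd-eis`, width seat `bsd-line-x2-p2` (prover g19, 2026-08-29; D-0154 KEY row 5). THEOREMS ONLY: no definition, no named
fact, no `sorry`, no instance, no notation. The END of this seat's W2-binder series: `TelescopeK2ControlOfCoefficients.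
exists_quotSMulTop_XBig_linearMap_of_coefficients` (the two-sided control in W2's dual shape, hypotheses on the coefficient module
only) with every hypothesis discharged from N1-SHAPED data, except the two that N1's FD does NOT supply (memo
`W2-BINDERS-x2p2g19.md` §2–§3, evidence #52 on -19034):

* (split) `W.HasSplitMultiplicativeReductionAtPrime p` — Cell C has `Mult W p` (split OR non-split); the `Gal(K̄_𝔭bar/K_{∞,𝔭bar})`-fixed
  `p`-power torsion of `E` is finite by bsd-stepL's Tate-uniformisation chain (L1) in the SPLIT case only
  (`…TelescopeK2FixedTorsionFiniteSplitMult`); the non-split twin is not in the tree.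
* (inert) `∀ w ∈ S₀` with `Sum.inr w` in the strict set: every `p`-primary `I_w`-fixed `a ∈ A₂` has a `p`-primary `I_w`-fixed `b` with
  `X • b = p^b₀ • a` — «`p^{b₀}` kills the `X`-cotorsion of `A₂^{I_w}[p^∞]`» (the (G5-w)/«constant inertia type» statement about the
  branch lattice; NOT a consequence of FD: at a ramified `w` with `ℚ_p/ℤ_p ⊆ A₂^{I_w}/X` no scalar prime to `C X` kills the `I_w`-defect).

Everything else is by name: (htor) = (tor); (hroot) ⟸ (cof₀) + (tor) + (fd₀) (p747595); (hfinK)/(hfin𝔭bar) ⟸ (fd₀) + (split) + Brink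
(F-file); (hsurj𝔭bar) = tree `AnticyclotomicLocalImage` (`p ≠ 2`); (hinert) at UNRAMIFIED `w ∉ S₀` ⟸ (unr) through the model bridge
`GreenbergSelmer.inertia w = (adicCompletionPrime K w).inertia Γ_K` (`inertia_adicCompletionPrime_eq_map_absInertia`) + (hroot);
(hnd) `X ∤ p^n` in `ℤ_p⟦X⟧`.

* `apply_localMap_inr_eq_self_of_isUnramifiedAt` — (unr) in the Selmer structure's inertia model: `ρ (localMap K (Sum.inr w) τ) a = a`.
* `not_X_dvd_natCast_pow` — `¬ X ∣ (p^n : ℤ_p⟦X⟧)`.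
* **`exists_weightTwoControlMap_of_inert_of_split`** — THE STATEMENT: for `K` imaginary quadratic, `p ≠ 2`, `κ` anticyclotomic, `𝔭bar ∋ p`
  of degree one, `E = W/ℚ` split multiplicative at `p`, and `ρ₂ : Γ_K → Aut_{ℤ_p⟦X⟧}(A₂)` with (tor), (cof₀), (unr `S₀`), (fd₀ `θ₀`), (inert):
  `∃ α : QuotSMulTop (C X) (XBig κ ρ₂ 𝔭bar ∅) →ₗ[ℤ_p⟦X⟧⟦T⟧] CharacterModule ↥(Sel(M₂[C X]))`, kernel killed elementwise by scalars prime to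
  `C X`, cokernel FINITE — the conclusion of `K2Weight2.stub_weightTwoControlMap` (`Cruxes/BSDpOnCellC/Lines/telescopeK2weight2.lean`)
  for these objects, token-shape.

HONEST FRAMING: this is W2's conclusion under TWO MORE hypotheses than the unregistered W2 text and at the object level (not under the
road-R-β prefix); whether the LEAD reshapes N1/N2 to carry (inert) (repair R1) or the inertia term is removed by the refined
`D_w`-analysis (repair R2) is the LEAD's act (W-79); nothing about any curve's BSD is proved; the branch lattice `ρ₂` is a binder, not
constructed; no registered stub, crux or summit statement is proved by this file; closes: none.

References: [Castella2018Erratum] Lemma 2.1 (p. 2); [JetchevSkinnerWan2017] §3.4, Lemma 3.4.1 (arXiv:1512.06894 p. 14); [Ochiai2006]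
Prop. 5.1 (Compositio 142 p. 1177: «the assertions on Coker(res_J) hold without Condition (Ir)»); [Brink2007] Cor. 1; [SilvermanATAEC1994]
Thm. V.5.3; [NeukirchANT1999] Ch. II (9.6).
-/

noncomputable section

-- D-0017: single-problem summit, the namespace repeats the problem name by design.
set_option linter.dupNamespace false
set_option autoImplicit false

open Field IsDedekindDomain NumberField WeierstrassCurve
open Literature.NumberTheory.GaloisRepresentations Literature.NumberTheory.EllipticCurves
  Literature.NumberTheory.EllipticCurves.BigRepModule Literature.NumberTheory.EllipticCurves.BigGaloisRep
open Summit.BirchSwinnertonDyer.Rank1Residual.X11b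

namespace Summit.BirchSwinnertonDyer.BirchSwinnertonDyer.Theorems.TelescopeK2WeightTwoControlMapOfInert

/-! ## §1 Two small inputs -/

/-- **(unr) in the Selmer structure's inertia model**: if `ρ` is unramified at `w` (Mathlib `Ideal.inertia` at every prime of `K̄` above
`w`), then the chosen inertia group `I_{K_w} → Γ_K` (`localMap K (Sum.inr w)`, image `GreenbergSelmer.inertia w = I_{𝔓₀}`,
`𝔓₀ = adicCompletionPrime K w`) acts trivially. [cite: NeukirchANT1999, Ch. II §9 Prop. (9.6)] [cite: Serre1968, Ch. I §2.1] -/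
theorem apply_localMap_inr_eq_self_of_isUnramifiedAt {K : Type} [Field K] [NumberField K]
    {𝒪 : Type*} [CommRing 𝒪] [TopologicalSpace 𝒪] {A : Type} [AddCommGroup A] [Module 𝒪 A] [TopologicalSpace A]
    (ρ : ContinuousRep (absoluteGaloisGroup K) 𝒪 A) {w : HeightOneSpectrum (𝓞 K)} (hw : GaloisRep.IsUnramifiedAt w ρ)
    (τ : LocalGroup K (Sum.inr w)) (a : A) : ρ (localMap K (Sum.inr w) τ) a = a := by
  have hmem : localMap K (Sum.inr w) τ ∈ GreenbergSelmer.inertia (K := K) w := by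
    rw [← range_localMap_inr]
    exact ⟨τ, rfl⟩
  have e : GreenbergSelmer.inertia (K := K) w = (adicCompletionPrime K w).inertia (absoluteGaloisGroup K) :=
    (inertia_adicCompletionPrime_eq_map_absInertia K w).symm
  rw [e] at hmem
  have h1 := hw _ (adicCompletionPrime_mem_primesAbove K w) _ hmem
  rw [h1]
  rfl

/-- `X ∤ p^n` in `ℤ_p⟦X⟧` (constant coefficients: `p^n ≠ 0`). [folklore] -/
theorem not_X_dvd_natCast_pow {p : ℕ} [Fact p.Prime] (n : ℕ) :
    ¬ ((PowerSeries.X : PowerSeries ℤ_[p]) ∣ ((p : PowerSeries ℤ_[p]) ^ n)) := by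
  intro h
  have h0 : PowerSeries.constantCoeff ((p : PowerSeries ℤ_[p]) ^ n) = 0 := PowerSeries.X_dvd_iff.1 h
  rw [map_pow, map_natCast] at h0
  exact pow_ne_zero _ (Nat.cast_ne_zero.2 (Nat.Prime.ne_zero Fact.out)) h0

/-! ## §2 W2's conclusion from N1-shaped data + (split) + (inert) -/

/-- **SUB-LEAF W2 FROM FIBRE DATA + (split) + (inert).** See the module docstring. The proof is the seat's coefficient-level control
`TelescopeK2ControlOfCoefficients.exists_quotSMulTop_XBig_linearMap_of_coefficients` at `(κ, ρ₂, 𝔭bar, ∅, c = X, d = p^{b₀})` with: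
(hroot) by `TelescopeK2BigRepDivisible.exists_primaryRoot_of_divisible` ((cof₀) + torsion of `A₂` from (tor) + (fd₀)); (hfinK)/(hfin𝔭bar) by
`TelescopeK2FixedTorsionFiniteSplitMult` ((fd₀) + (split) + Brink); (hsurj𝔭bar) by `AnticyclotomicLocalImage`; (hinert) from (inert) at
`w ∈ S₀` and from (unr) + (hroot) at `w ∉ S₀`; (hnd) `X ∤ p^{b₀+a}`.
[cite: JetchevSkinnerWan2017, §3.4, Lemma 3.4.1 (arXiv:1512.06894 p. 14)] [cite: Ochiai2006, Prop. 5.1 (Compositio 142 p. 1177)]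
[cite: Castella2018Erratum, Lemma 2.1 (p. 2)] [cite: Brink2007, Cor. 1 (p. 2136)] -/
theorem exists_weightTwoControlMap_of_inert_of_split {K : Type} [Field K] [NumberField K] {p : ℕ} [Fact p.Prime]
    (W : WeierstrassCurve ℚ) [W.IsElliptic] (hK : IsImaginaryQuadratic K) (hp2 : p ≠ 2)
    (hsplit : W.HasSplitMultiplicativeReductionAtPrime p)
    (κ : ZpExtension K p) (hκ : κ.IsAnticyclotomic)
    (𝔭bar : HeightOneSpectrum (𝓞 K)) (h𝔭bar : ((p : ℕ) : 𝓞 K) ∈ 𝔭bar.asIdeal)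
    (he : 𝔭bar.asIdeal.ramificationIdx (𝓞 ℚ) = 1) (hf : 𝔭bar.asIdeal.inertiaDeg (𝓞 ℚ) = 1)
    [TopologicalSpace (PowerSeries ℤ_[p])] (A₂ : Type) [AddCommGroup A₂] [Module (PowerSeries ℤ_[p]) A₂]
    [TopologicalSpace A₂] [DiscreteTopology A₂]
    (ρ₂ : ContinuousRep (absoluteGaloisGroup K) (PowerSeries ℤ_[p]) A₂)
    [TopologicalSpace (PowerSeries (PowerSeries ℤ_[p]))]
    [ContinuousSMul (PowerSeries (PowerSeries ℤ_[p])) (BigRepModule (PowerSeries ℤ_[p]) p A₂)]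
    -- (tor), (cof₀), (unr), (fd₀) of N1's fibre data
    (htor : ∀ a : A₂, ∃ n : ℕ, (PowerSeries.X : PowerSeries ℤ_[p]) ^ n • a = 0)
    (hcof : ∀ a : A₂, ∃ b : A₂, (PowerSeries.X : PowerSeries ℤ_[p]) • b = a)
    (S₀ : Set (HeightOneSpectrum (𝓞 K))) (hunr : GaloisRep.IsUnramifiedOutside S₀ ρ₂)
    (θ₀ : Submodule.torsionBy (PowerSeries ℤ_[p]) A₂ (PowerSeries.X : PowerSeries ℤ_[p]) →+
      PrimaryTorsion (W.baseChange K).geomPoints p)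
    (hθσ : ∀ (σ : absoluteGaloisGroup K)
      (a : Submodule.torsionBy (PowerSeries ℤ_[p]) A₂ (PowerSeries.X : PowerSeries ℤ_[p])),
      θ₀ (BigGaloisRep.torsionRep ρ₂ (PowerSeries.X : PowerSeries ℤ_[p]) σ a) =
        (W.baseChange K).primaryTorsionGaloisRep p σ (θ₀ a))
    (hker : Finite θ₀.ker)
    -- (inert): the inertia clause at the ramified primes, exponent `b₀`
    (b₀ : ℕ)
    (hinert : ∀ w ∈ S₀, (Sum.inr w : LocalIndex K) ∈ strictSet p 𝔭bar (∅ : Set (HeightOneSpectrum (𝓞 K))) →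
      ∀ a : A₂, (∀ τ : LocalGroup K (Sum.inr w), ρ₂ (localMap K (Sum.inr w) τ) a = a) → (∃ k : ℕ, p ^ k • a = 0) →
        ∃ b : A₂, (∀ τ : LocalGroup K (Sum.inr w), ρ₂ (localMap K (Sum.inr w) τ) b = b) ∧
          (∃ k : ℕ, p ^ k • b = 0) ∧ (PowerSeries.X : PowerSeries ℤ_[p]) • b = ((p : PowerSeries ℤ_[p]) ^ b₀) • a) :
    ∃ α : QuotSMulTop (PowerSeries.C (PowerSeries.X : PowerSeries ℤ_[p])) (XBig κ ρ₂ 𝔭bar (∅ : Set (HeightOneSpectrum (𝓞 K))))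
        →ₗ[PowerSeries (PowerSeries ℤ_[p])]
        CharacterModule (TorsionControl.selmer (localMap K) (strictSet p 𝔭bar (∅ : Set (HeightOneSpectrum (𝓞 K))))
          (TorsionControl.torsionRep (AnticyclotomicBigGaloisRep κ ρ₂) (PowerSeries.C (PowerSeries.X : PowerSeries ℤ_[p])))),
      (∀ m ∈ LinearMap.ker α, ∃ s : PowerSeries (PowerSeries ℤ_[p]),
        ¬ ((PowerSeries.C (PowerSeries.X : PowerSeries ℤ_[p])) ∣ s) ∧ s • m = 0) ∧
      Finite ((CharacterModule (TorsionControl.selmer (localMap K) (strictSet p 𝔭bar (∅ : Set (HeightOneSpectrum (𝓞 K))))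
        (TorsionControl.torsionRep (AnticyclotomicBigGaloisRep κ ρ₂) (PowerSeries.C (PowerSeries.X : PowerSeries ℤ_[p]))))) ⧸
          LinearMap.range α) := by
  -- torsion of `A₂` from (tor) + (fd₀): `E[p^∞]` is torsion
  have hP : ∀ e : PrimaryTorsion (W.baseChange K).geomPoints p, IsOfFinAddOrder e := fun e => by
    obtain ⟨k, hk⟩ := PrimaryTorsion.exists_pow_smul_eq_zero e
    refine (isOfFinAddOrder_iff_nsmul_eq_zero).2 ⟨p ^ k, pow_pos (Nat.Prime.pos Fact.out) k, ?_⟩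
    apply PrimaryTorsion.ext
    rw [PrimaryTorsion.val_nsmul, hk, PrimaryTorsion.val_zero]
  have htors : ∀ a : A₂, IsOfFinAddOrder a :=
    TelescopeK2BigRepDivisible.isOfFinAddOrder_of_pow_torsion PowerSeries.X htor
      (TelescopeK2BigRepDivisible.isOfFinAddOrder_of_torsionBy PowerSeries.X θ₀ hker hP)
  have hroot : ∀ a : A₂, (∃ k : ℕ, p ^ k • a = 0) →
      ∃ b : A₂, (∃ k : ℕ, p ^ k • b = 0) ∧ (PowerSeries.X : PowerSeries ℤ_[p]) • b = a :=
    TelescopeK2BigRepDivisible.exists_primaryRoot_of_divisible PowerSeries.X hcof htors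
  -- the open image at `𝔭bar` (Brink) and the two finite fixed sets (Tate uniformisation)
  obtain ⟨s, hsurj⟩ :=
    AnticyclotomicLocalImage.anticyclotomic_exists_forall_exists_toAdd_eq_pow_mul hK hp2 κ hκ 𝔭bar h𝔭bar
  have hfinloc := TelescopeK2FixedTorsionFiniteSplitMult.finite_fixed_torsionBy_local_of_splitMult W κ ρ₂ PowerSeries.X θ₀
    hp2 hsplit 𝔭bar h𝔭bar he hf hsurj hθσ hker
  have hfinK := TelescopeK2FixedTorsionFiniteSplitMult.finite_fixed_torsionBy_global_of_local κ ρ₂ PowerSeries.X 𝔭bar hfinloc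
  refine TelescopeK2ControlOfCoefficients.exists_quotSMulTop_XBig_linearMap_of_coefficients κ ρ₂ 𝔭bar ∅
    PowerSeries.X ((p : PowerSeries ℤ_[p]) ^ b₀) (fun a _ => htor a) hroot hfinK hsurj hfinloc ?_ ?_
  · -- (hinert): ramified primes by (inert), unramified ones by (unr) + (hroot)
    intro w hw a ha hk
    by_cases hwS : w ∈ S₀
    · exact hinert w hwS hw a ha hk
    · -- `I_w` acts trivially on `A₂`
      have htriv : ∀ (τ : LocalGroup K (Sum.inr w)) (b : A₂), ρ₂ (localMap K (Sum.inr w) τ) b = b :=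
        fun τ b => apply_localMap_inr_eq_self_of_isUnramifiedAt ρ₂ (hunr w hwS) τ b
      obtain ⟨k, hk⟩ := hk
      obtain ⟨b, hbp, hb⟩ := hroot (((p : PowerSeries ℤ_[p]) ^ b₀) • a)
        ⟨k, by rw [smul_comm, hk, smul_zero]⟩
      exact ⟨b, fun τ => htriv τ b, hbp, hb⟩
  · -- (hnd): `X ∤ p^{b₀} · p^a`
    intro a h
    rw [← pow_add] at h
    exact not_X_dvd_natCast_pow (b₀ + a) h

end Summit.BirchSwinnertonDyer.BirchSwinnertonDyer.Theorems.TelescopeK2WeightTwoControlMapOfInert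

end
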